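import Summits.QuantumFields.BalabanUV.Beta.GAN24.ExchangeBondLegs
import Summits.QuantumFields.BalabanUV.Beta.GAN24.SecondResponseReadout
import Summits.QuantumFields.BalabanUV.Beta.GAN24.MixedChannelZeroMode

/-!
# `BalabanUV.Beta.GAN24.ExchangeZeroMode` — row G-an2-4 ∕ (CONV-C), W-slot, road «W3» (SKELETON-W3 §7.2 ∕ §8.3 (F2)), «W3-S3C*» PART 6
# module (C2): THE EXCHANGE CHANNEL OF THE BRACKET HAS ZERO FIELD–FIELD ZERO MODE, IN BOTH BOND ORIENTATIONS —
# `Σ'_{u′} Σ'_{x′} Σ'_{z′} mmRead N ((K ∘ dM_{(κ,u)}) ∘ ((K ∘ dM_{(κ′,u′)}) ∘ K)) x′ z′ (inl α) (inl β) = 0` and the same with the summed bond in the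
# first factor, at EVERY first bond `(κ, u)` (leaf-16's pointwise transversal form) — the two exchange trees of gen 8's `ExchangeReadout.K3OfK_apply_eq`

NOT IN PRINT; OUR BOOKKEEPING (idle-seat kernel lemma, unit `b2b-balaban-gan24-formalise-leaf-06`, gen 9).  HONEST FRAMING (cell contract,
verbatim): «discharging `BetaPertH` makes Bałaban's UV stability UNCONDITIONAL — a real constructive-QFT result; it is NOT the continuum limit and
NOT the Clay problem.»  HONEST DEPENDENCY (verbatim): «continuum YM on T⁴ ⇐ BetaPertH ∧ nine spine estimates (0/9 proved); BetaPertH ⇐ (D1) ∧ (D4)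
∧ CAP+tail; G-an2-4 gates asym, D1 and NE2/3/4.»

WHY (the located use).  ROW W3-F2a reads `∀ m, Zfree (b m)` for leaf-04's bracket `b_j = (cE₂·Lc^{2(d+1)}) • mmRead Lc ∘ K3OfK K♮_j Lc S♮_j M♮_j W♮⁰_j
+ border`; `K3OfK`'s first two summands are the EXCHANGE TREES `K♮ ∘ dM_b ∘ K♮ ∘ dM_{b′} ∘ K♮` and `K♮ ∘ dM_{b′} ∘ K♮ ∘ dM_b ∘ K♮` (gen 8
`K3OfK_apply_eq`; SKELETON-W3 §7.2: «Z of each exchange tree K̃∘dM̃(c)∘K̃∘dM̃(c′)∘K̃ on (c″, c‴) = K̃_mm[c̃″, q′] = 0 ((S3c) twice turns the ff-blocks off,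
the surviving multiplier vectors q, q′ are constant by (Q-lin) and die on K̃_mm by (S2c))»).  Generic `d`, `N ≥ 1`; `K` given by decay, SITE-FREE
coarse-leg charges vanishing on multiplier legs, multiplier SECOND legs vanishing off the coarse lattice (and block covariance for the swapped
orientation); `S` a local stencil family with (S3c) (legs pair ∧ table + second leg) as HYPOTHESES and block covariance; `M` block-covariant:
* §1 `tree_shiftK`, `exchangeTree_translate` — the exchange-tree bi-table family is covariant under all coarse unit translations (an2's
  `dM_translate`, `comp_shiftK`, `mmRead_shiftK_smul`).
* §2 **`hasSum_inner_exchange`** ∕ **`inner_exchange_eq_zero`** (summed bond in the SECOND factor; `HasSum` over the bond, and `tsum` form): per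
  bond the read-out is gen 8's `hasSum_exchange_readout` (only ff charges
  survive, module (B1) `tsum_readout_eq`), and the bond series of the middle kernel's double-leg sums vanishes termwise — module (C1)
  `hasSum_bond_legs_exchange`.
* §3 **`inner_exchange_swap_eq_zero`** (summed bond in the FIRST factor): leaf-14's transposition `MixedChannelZeroMode.inner_tsum_firstBond_eq`
  moves the bond sum onto the second factor (§1 covariance), then §2 at the first bond `(κ′, 0)`.
`zmode` forms and the W3 step instances follow in the step module.  [folklore] composition of tree theorems BY NAME; asserts NO shape or value of
Bałaban's tables, pins no colour constant; discharges NOTHING of ROW W3-F2a ∕ F2b, «T2Shape» ∕ «T2SupRate», (hW, hWall); 0 wall binders; NOT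
«W-slot closed», NEVER «G-an2-4 closed»; NOT BetaPertH, NOT continuum, NOT Clay.  0 `def`, 0 cite, 0 sorry.
-/

noncomputable section

open Finset
open scoped BigOperators
open Literature.MathematicalPhysics.QuantumFieldTheory
open Literature.MathematicalPhysics.QuantumFieldTheory.Balaban1983to89
open Literature.MathematicalPhysics.QuantumFieldTheory.Balaban1983to89.Beta
open Literature.Probability.LatticeModels (Torus.proj)
open ExpKernelCalculus (Site MKer BiLoc Decays VertexFamily comp shiftK comp_shiftK)
open OneStepResolventKernel (Fib LocStencil)
open SecondOrderResponse (dM vertexFamily_dM dM_translate)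
open BalabanStepJetsSucc (mmRead mmRead_inl_inl mmRead_shiftK_smul)
open Summit.QuantumFields.BalabanUV.Beta.TameKernelCalculus (Spr Loc)
open Summit.QuantumFields.BalabanUV.Beta.GAN24.KernelLegCharges (summable_prod_of_biLoc)
open Summit.QuantumFields.BalabanUV.Beta.GAN24.ExchangeReadout (hasSum_exchange_readout)
open Summit.QuantumFields.BalabanUV.Beta.GAN24.MixedChannelZeroMode (inner_tsum_firstBond_eq)
open Summit.QuantumFields.BalabanUV.Beta.GAN24.SecondResponseReadout (tsum_readout_eq)
open Summit.QuantumFields.BalabanUV.Beta.GAN24.ExchangeBondLegs (hasSum_bond_legs_exchange)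

namespace Summit.QuantumFields.BalabanUV.Beta.GAN24.ExchangeZeroMode

variable {d : ℕ} {N : ℕ} [NeZero N]
variable {K : MKer (d + 1) (Fib d)} {C m : ℝ} {ρL ρR : Fin (d + 1) → Fib d → ℝ}
  {S : Fin (d + 1) → Site (d + 1) → MKer (d + 1) (Fib d)} {Cs : ℝ}
  {M : Fin (d + 1) → Site (d + 1) → MKer (d + 1) (Fib d)} {CM : ℝ}

/-! ## §1 Coarse unit covariance of the exchange-tree family -/

omit [NeZero N] in
/-- [folklore] An exchange tree of shifted middle kernels through a shift-invariant `K` is the shifted exchange tree (`comp_shiftK` four times). -/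
theorem tree_shiftK {P Q : MKer (d + 1) (Fib d)} {s : Site (d + 1)} (hK : shiftK s K = K) :
    comp (comp K (shiftK s P)) (comp (comp K (shiftK s Q)) K) = shiftK s (comp (comp K P) (comp (comp K Q) K)) := by
  conv_rhs => rw [← comp_shiftK, ← comp_shiftK, ← comp_shiftK, ← comp_shiftK, hK]

/-- [folklore] **COARSE UNIT COVARIANCE OF THE EXCHANGE-TREE FAMILY**: for a block-covariant `K`, a block-covariant stencil family `S` and a
coarse-covariant `M`, `mmRead N ((K ∘ dM_{(κ,u+t)}) ∘ ((K ∘ dM_{(κ′,u′+t)}) ∘ K)) = shiftK (−t) (mmRead N ((K ∘ dM_{(κ,u)}) ∘ ((K ∘ dM_{(κ′,u′)}) ∘ K)))`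
(an2's `dM_translate` ⨾ `tree_shiftK` ⨾ `mmRead_shiftK_smul`) — the `hX` hypothesis shape of leaf-14's `inner_tsum_firstBond_eq`. -/
theorem exchangeTree_translate (hKs : ∀ t : Site (d + 1), shiftK (-((N : ℤ) • t)) K = K)
    (hSt : ∀ (κ : Fin (d + 1)) (u s : Site (d + 1)), S κ (u + (N : ℤ) • s) = shiftK (-((N : ℤ) • s)) (S κ u))
    (hMt : ∀ (ρ : Fin (d + 1)) (w t : Site (d + 1)), M ρ (w + t) = shiftK (-((N : ℤ) • t)) (M ρ w))
    (κ : Fin (d + 1)) (u : Site (d + 1)) (κ' : Fin (d + 1)) (u' t : Site (d + 1)) :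
    mmRead N (comp (comp K (dM K N S M κ (u + t))) (comp (comp K (dM K N S M κ' (u' + t))) K))
      = shiftK (-t) (mmRead N (comp (comp K (dM K N S M κ u)) (comp (comp K (dM K N S M κ' u')) K))) := by
  rw [dM_translate hKs hSt hMt κ u t, dM_translate hKs hSt hMt κ' u' t, tree_shiftK (hKs t), mmRead_shiftK_smul]

/-! ## §2 Summed bond in the second factor -/

/-- [folklore] **THE EXCHANGE CHANNEL, summed bond in the SECOND factor — `HasSum` OVER THE BOND of the transversal inner sums** (the form an
assembler adds up).  For a packed kernel `K` (decay `m > 0`; site-free coarse-leg charges `ρL α`, `ρR β` vanishing on the multiplier legs — (Q-lin)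
on field legs, (S2c) on multiplier legs; multiplier second legs vanishing off the coarse lattice), a local stencil family `S` with the (S3c) sum rules
«legs pair» and «table + second leg» and block covariance, and a block-covariant vertex family `M`: for EVERY first bond `(κ, u)`,
`HasSum (u′ ↦ Σ'_{x′} Σ'_{z′} mmRead N ((K ∘ dM K N S M κ u) ∘ ((K ∘ dM K N S M κ′ u′) ∘ K)) x′ z′ (inl α) (inl β)) 0`. -/
theorem hasSum_inner_exchange (hK : Decays K C m) (hm : 0 < m)
    (hrow : ∀ α f y, HasSum (fun x' : Site (d + 1) => K ((N : ℤ) • x') y (Sum.inr α) f) (ρL α f))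
    (hcol : ∀ β g w, HasSum (fun z' : Site (d + 1) => K w ((N : ℤ) • z') g (Sum.inr β)) (ρR β g))
    (hL0 : ∀ α μ, ρL α (Sum.inr μ) = 0) (hR0 : ∀ β μ, ρR β (Sum.inr μ) = 0)
    (hoffR : ∀ (x z : Site (d + 1)) (a : Fib d) (ρ : Fin (d + 1)), Torus.proj N z ≠ 0 → K x z a (Sum.inr ρ) = 0)
    (hS : LocStencil S Cs m)
    (hS0 : ∀ (κ : Fin (d + 1)) (t : Site (d + 1)) (a b : Fin (d + 1)),
      HasSum (fun vp : Site (d + 1) × Site (d + 1) => S κ t vp.1 vp.2 (Sum.inl a) (Sum.inl b)) 0)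
    (hS2 : ∀ (κ : Fin (d + 1)) (p : Site (d + 1)) (a b : Fin (d + 1)),
      HasSum (fun tq : Site (d + 1) × Site (d + 1) => S κ tq.1 p tq.2 (Sum.inl a) (Sum.inl b)) 0)
    (hSt : ∀ (κ : Fin (d + 1)) (u s : Site (d + 1)), S κ (u + (N : ℤ) • s) = shiftK (-((N : ℤ) • s)) (S κ u))
    (hM : VertexFamily M N CM m) (hMt : ∀ (ρ : Fin (d + 1)) (w t : Site (d + 1)), M ρ (w + t) = shiftK (-((N : ℤ) • t)) (M ρ w))
    (κ : Fin (d + 1)) (u : Site (d + 1)) (κ' α β : Fin (d + 1)) :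
    HasSum (fun u' : Site (d + 1) => ∑' x', ∑' z', mmRead N (comp (comp K (dM K N S M κ u)) (comp (comp K (dM K N S M κ' u')) K)) x' z'
      (Sum.inl α) (Sum.inl β)) 0 := by
  have hC : 0 ≤ C := hK.nonneg (Sum.inl 0)
  have hm2 : 0 < m / 2 := half_pos hm
  have hKs : Spr K := ⟨C, m, hm, hK⟩
  have hV := vertexFamily_dM (N := N) hK hC hS hM hm le_rfl
  have hLoc : ∀ (ν : Fin (d + 1)) (y : Site (d + 1)), Loc (dM K N S M ν y) := fun ν y => ⟨_, _, _, _, hm2, hV ν y⟩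
  -- per bond: gen 8's exchange read-out, only the ff charges survive
  have hval : ∀ u' : Site (d + 1),
      (∑' x', ∑' z', mmRead N (comp (comp K (dM K N S M κ u)) (comp (comp K (dM K N S M κ' u')) K)) x' z' (Sum.inl α) (Sum.inl β))
        = ∑ a : Fin (d + 1), ∑ b : Fin (d + 1), ρL α (Sum.inl a) * ρR β (Sum.inl b) *
            ∑' vw : Site (d + 1) × Site (d + 1),
              comp (comp (dM K N S M κ u) K) (dM K N S M κ' u') vw.1 vw.2 (Sum.inl a) (Sum.inl b) := by
    intro u'
    have hread := hasSum_exchange_readout (N := N) hK hm (hLoc κ u) (hLoc κ' u') α β (hrow α) (hcol β)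
    obtain ⟨p, q, Cv, δv, hδv, hVb⟩ := ((hLoc κ u).comp_spr hKs).comp (hLoc κ' u')
    have hpair : (∑' x', ∑' z', mmRead N (comp (comp K (dM K N S M κ u)) (comp (comp K (dM K N S M κ' u')) K)) x' z'
        (Sum.inl α) (Sum.inl β))
        = ∑' xz : Site (d + 1) × Site (d + 1), comp (comp K (dM K N S M κ u)) (comp (comp K (dM K N S M κ' u')) K)
            ((N : ℤ) • xz.1) ((N : ℤ) • xz.2) (Sum.inr α) (Sum.inr β) := by
      simp only [mmRead_inl_inl]
      exact (hread.summable.tsum_prod).symm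
    rw [hpair, hread.tsum_eq, tsum_readout_eq (hL0 α) (hR0 β) (fun f g => summable_prod_of_biLoc hVb hδv f g)]
  have hcore : ∀ a b : Fin (d + 1), HasSum (fun u' : Site (d + 1) => ∑' vw : Site (d + 1) × Site (d + 1),
      comp (comp (dM K N S M κ u) K) (dM K N S M κ' u') vw.1 vw.2 (Sum.inl a) (Sum.inl b)) 0 :=
    fun a b => hasSum_bond_legs_exchange hK hm hrow hcol hL0 hR0 hoffR hS hS0 hS2 hSt hM hMt κ u κ' a b
  have h := hasSum_sum (s := (Finset.univ : Finset (Fin (d + 1)))) fun a _ =>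
    hasSum_sum (s := (Finset.univ : Finset (Fin (d + 1)))) fun b _ => (hcore a b).mul_left (ρL α (Sum.inl a) * ρR β (Sum.inl b))
  simp only [mul_zero, Finset.sum_const_zero] at h
  exact h.congr_fun fun u' => (hval u').symm ▸ rfl

/-- [folklore] **THE EXCHANGE CHANNEL HAS ZERO ff ZERO MODE — summed bond in the SECOND factor, pointwise transversal form**:
`Σ'_{u′} Σ'_{x′} Σ'_{z′} mmRead N ((K ∘ dM K N S M κ u) ∘ ((K ∘ dM K N S M κ′ u′) ∘ K)) x′ z′ (inl α) (inl β) = 0` for EVERY first bond `(κ, u)`. -/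
theorem inner_exchange_eq_zero (hK : Decays K C m) (hm : 0 < m)
    (hrow : ∀ α f y, HasSum (fun x' : Site (d + 1) => K ((N : ℤ) • x') y (Sum.inr α) f) (ρL α f))
    (hcol : ∀ β g w, HasSum (fun z' : Site (d + 1) => K w ((N : ℤ) • z') g (Sum.inr β)) (ρR β g))
    (hL0 : ∀ α μ, ρL α (Sum.inr μ) = 0) (hR0 : ∀ β μ, ρR β (Sum.inr μ) = 0)
    (hoffR : ∀ (x z : Site (d + 1)) (a : Fib d) (ρ : Fin (d + 1)), Torus.proj N z ≠ 0 → K x z a (Sum.inr ρ) = 0)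
    (hS : LocStencil S Cs m)
    (hS0 : ∀ (κ : Fin (d + 1)) (t : Site (d + 1)) (a b : Fin (d + 1)),
      HasSum (fun vp : Site (d + 1) × Site (d + 1) => S κ t vp.1 vp.2 (Sum.inl a) (Sum.inl b)) 0)
    (hS2 : ∀ (κ : Fin (d + 1)) (p : Site (d + 1)) (a b : Fin (d + 1)),
      HasSum (fun tq : Site (d + 1) × Site (d + 1) => S κ tq.1 p tq.2 (Sum.inl a) (Sum.inl b)) 0)
    (hSt : ∀ (κ : Fin (d + 1)) (u s : Site (d + 1)), S κ (u + (N : ℤ) • s) = shiftK (-((N : ℤ) • s)) (S κ u))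
    (hM : VertexFamily M N CM m) (hMt : ∀ (ρ : Fin (d + 1)) (w t : Site (d + 1)), M ρ (w + t) = shiftK (-((N : ℤ) • t)) (M ρ w))
    (κ : Fin (d + 1)) (u : Site (d + 1)) (κ' α β : Fin (d + 1)) :
    (∑' u', ∑' x', ∑' z', mmRead N (comp (comp K (dM K N S M κ u)) (comp (comp K (dM K N S M κ' u')) K)) x' z'
      (Sum.inl α) (Sum.inl β)) = 0 :=
  (hasSum_inner_exchange hK hm hrow hcol hL0 hR0 hoffR hS hS0 hS2 hSt hM hMt κ u κ' α β).tsum_eq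

/-! ## §3 Summed bond in the first factor -/

/-- [folklore] **THE EXCHANGE CHANNEL HAS ZERO ff ZERO MODE — summed bond in the FIRST factor, pointwise transversal form.**  Under the hypotheses of
`inner_exchange_eq_zero` plus block covariance of `K`: for EVERY first bond `(κ, u)`,
`Σ'_{u′} Σ'_{x′} Σ'_{z′} mmRead N ((K ∘ dM K N S M κ′ u′) ∘ ((K ∘ dM K N S M κ u) ∘ K)) x′ z′ (inl α) (inl β) = 0` (the second exchange tree of
`K3OfK_apply_eq`; leaf-14's transposition moves the bond sum onto the second factor, §1 supplies the covariance). -/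
theorem inner_exchange_swap_eq_zero (hK : Decays K C m) (hm : 0 < m) (hKs : ∀ t : Site (d + 1), shiftK (-((N : ℤ) • t)) K = K)
    (hrow : ∀ α f y, HasSum (fun x' : Site (d + 1) => K ((N : ℤ) • x') y (Sum.inr α) f) (ρL α f))
    (hcol : ∀ β g w, HasSum (fun z' : Site (d + 1) => K w ((N : ℤ) • z') g (Sum.inr β)) (ρR β g))
    (hL0 : ∀ α μ, ρL α (Sum.inr μ) = 0) (hR0 : ∀ β μ, ρR β (Sum.inr μ) = 0)
    (hoffR : ∀ (x z : Site (d + 1)) (a : Fib d) (ρ : Fin (d + 1)), Torus.proj N z ≠ 0 → K x z a (Sum.inr ρ) = 0)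
    (hS : LocStencil S Cs m)
    (hS0 : ∀ (κ : Fin (d + 1)) (t : Site (d + 1)) (a b : Fin (d + 1)),
      HasSum (fun vp : Site (d + 1) × Site (d + 1) => S κ t vp.1 vp.2 (Sum.inl a) (Sum.inl b)) 0)
    (hS2 : ∀ (κ : Fin (d + 1)) (p : Site (d + 1)) (a b : Fin (d + 1)),
      HasSum (fun tq : Site (d + 1) × Site (d + 1) => S κ tq.1 p tq.2 (Sum.inl a) (Sum.inl b)) 0)
    (hSt : ∀ (κ : Fin (d + 1)) (u s : Site (d + 1)), S κ (u + (N : ℤ) • s) = shiftK (-((N : ℤ) • s)) (S κ u))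
    (hM : VertexFamily M N CM m) (hMt : ∀ (ρ : Fin (d + 1)) (w t : Site (d + 1)), M ρ (w + t) = shiftK (-((N : ℤ) • t)) (M ρ w))
    (κ : Fin (d + 1)) (u : Site (d + 1)) (κ' α β : Fin (d + 1)) :
    (∑' u', ∑' x', ∑' z', mmRead N (comp (comp K (dM K N S M κ' u')) (comp (comp K (dM K N S M κ u)) K)) x' z'
      (Sum.inl α) (Sum.inl β)) = 0 := by
  have h := inner_tsum_firstBond_eq
    (X := fun k₁ v k₂ w => mmRead N (comp (comp K (dM K N S M k₁ v)) (comp (comp K (dM K N S M k₂ w)) K)))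
    (fun k₁ v k₂ w t => exchangeTree_translate hKs hSt hMt k₁ v k₂ w t) κ' κ (Sum.inl α) (Sum.inl β) 0 u
  rw [← h]
  exact inner_exchange_eq_zero hK hm hrow hcol hL0 hR0 hoffR hS hS0 hS2 hSt hM hMt κ' 0 κ α β

end Summit.QuantumFields.BalabanUV.Beta.GAN24.ExchangeZeroMode

end
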